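import Summits.BirchSwinnertonDyer.BirchSwinnertonDyer.Theorems.PrintCf2DisegniPairTwoChiPairingSeam
import Literature.NumberTheory.QuadraticFields.SquareRootGenerator
import HarnessLib

/-!
# Road (C) `disegni-pair-two` on crux stmt-BirchSwinnertonDyer-20368 — SEAM S1 in the TOWER frame
# `ℚ ⊂ E′ ⊂ H = E′(√d*)`: the `χ`-pairings of Disegni's clauses read ONE rational multiple of the member's height

Cell `bsd-print-cf2` (`run/shared/lean/pub/bsd-print-cf2/`), width seat `bsd-line-cf2-p1-w8` g22; sequel of
`PrintCf2DisegniPairTwoChiPairingSeam.lean` (the BIQUADRATIC frame with two commuting involutions `τ, κ` of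
`H/ℚ`). `--supports stmt-BirchSwinnertonDyer-20368` (helper). THEOREMS ONLY (no `def`, no named fact, no
`sorry`). BSD is not proved by any of this; no summit statement is claimed; 20368 is not closed here.

## Why a second frame

The typer's turnkey for the road-(C) print-conjoined stub (residue (R2) of `bsd-print-cf2-ty2` g49) reads
Disegni's clauses on `H := E′(√d*)` for an imaginary quadratic FIELD `E′` (a type with `IsImaginaryQuadratic`,
delivered by the Friedberg–Hoffstein / Heegner facts) and `G = Gal(H/E′) ≤ Aut(H/ℚ)`: the natural Lean frame is
a TOWER `[Algebra E′ H]`, `finrank E′ H = 2`, `s ∈ H`, `s² = d*`, `s ∉ E′` — not a biquadratic field with a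
lift `κ ∈ Aut(H/ℚ)` of the conjugation of `E′`. This file re-runs the descent of the biquadratic file ONE LAYER
AT A TIME, so that no automorphism of `H` moving `√d_{E′}` is needed:

* §1 one quadratic layer `F ⊂ K = F(θ)`: an `F`-algebra map with `σθ = −θ` fixes exactly `F`
  (`exists_algebraMap_eq_of_apply_gen_eq_neg`, from the tree's `Quadratic.exists_eq_add_mul`/`ext_add_mul`),
  and the point version `exists_map_eq_of_map_eq_tower` (a `σ`-fixed point of `X(K)` comes from `X(F)` along
  `IsScalarTower.toAlgHom`);
* §2 ★ `two_smul_eq_zsmul_memberPoint_add_torsion_tower`: `τ ∈ Aut(H/ℚ)` fixing `E′` with `τt = −t`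
  (`t² = d`), `c ∈ Aut(E′/ℚ)` with `cu = −u` (`u² = e = d_{E′}`), `V^{(d)}(ℚ) = ℤP + torsion`,
  `V^{(d)(e)}(ℚ)` torsion ⟹ every `R ∈ V(H)` with `τR = −R` has `2R = k·Φ_H(ιP) + T`, `T` torsion
  (`Q = Φ_H⁻¹R` is `τ`-fixed hence from `E′`; over `E′`, `Q₀ + cQ₀` is rational and `Q₀ − cQ₀ = Ψ_{E′}(Q₃)`
  with `Q₃` rational on the companion twist — the substitution `Ψ_{E′} = twistPointEquivOver (V^{(d)}) (u)`
  over `E′` itself);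
* §3 ★★ `exists_rat_chiPairings_eq_tower`: the SEAM in the tower frame — for all `y₁, y₂ ∈ V(H)` ONE `r ∈ ℚ`
  with `chiHeightPairing V H G χ y₁ y₂ = r·[H:ℚ]·ĥ(P)` and, for every `G`-invariant datum `DH`,
  `chiPAdicPairing ι V H DH G χ y₁ y₂ = r·⟨P′, P′⟩_{DH}`, `P′ = Φ_H(ιP)`;
* §4 the frame's automorphisms EXIST by name: `exists_algEquiv_tower` (`τ` = the tree's `Quadratic.conj` of
  `H/E′` made a `ℚ`-algebra automorphism) — and `c` is the tree's `sigmaQ` of `E′/ℚ` (`sigmaQ_gen`).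

References: D. Disegni, Compos. Math. 153 (2017) §1.1.1, (1.1.3), (1.3.2), Thm. B [Disegni2017];
B. Gross, D. Zagier, Invent. Math. 84 (1986) V.§2 p. 311 [GrossZagier1986]; J. H. Silverman, AEC (2009)
X.5 Cor. 5.4, Exercise 10.16, VIII.5.4(b) [SilvermanAEC2009].
-/

set_option autoImplicit false
set_option linter.dupNamespace false

noncomputable section

open scoped Classical

open Module WeierstrassCurve WeierstrassCurve.Affine.Point Literature.NumberTheory.EllipticCurves
  Literature.NumberTheory.EllipticCurves.Disegni2017 Literature.NumberTheory.QuadraticFields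
  Summit.BirchSwinnertonDyer.Rank1Residual.AdditivePotMult

namespace Summit.BirchSwinnertonDyer.BirchSwinnertonDyer.Theorems.PrintCf2.DisegniPairTwo

/-! ### §1 One quadratic layer `F ⊂ K = F(θ)` -/

section Layer

variable {F K : Type*} [Field F] [Field K] [Algebra F K] [NeZero (2 : F)]

/-- **An `F`-algebra map negating the generator of a quadratic extension fixes exactly `F`**: `[K:F] = 2`,
`θ ∉ F`, `σθ = −θ`, `σx = x` ⟹ `x ∈ F` (`x = a + bθ ↦ a − bθ`, so `2bθ = 0`). [folklore] -/
theorem exists_algebraMap_eq_of_apply_gen_eq_neg (h2 : finrank F K = 2) {θ : K}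
    (hθ : θ ∉ Set.range (algebraMap F K)) (σ : K →ₐ[F] K) (hσ : σ θ = -θ) {x : K} (hx : σ x = x) :
    ∃ a : F, algebraMap F K a = x := by
  obtain ⟨a, b, rfl⟩ := Quadratic.exists_eq_add_mul h2 hθ x
  rw [map_add, map_mul, AlgHom.commutes, AlgHom.commutes, hσ] at hx
  have h0 : (2 : K) * (algebraMap F K b * θ) = 0 := by linear_combination -hx
  rcases mul_eq_zero.mp h0 with h | h
  · exact absurd h (Quadratic.two_ne_zero' (F := F))
  · exact ⟨a, by rw [h, add_zero]⟩

/-- **Point version**: in a tower `S ⊂ F ⊂ K` with `[K:F] = 2`, `K = F(θ)`, an `S`-automorphism `σ` of `K`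
fixing `F` pointwise with `σθ = −θ`, every `σ`-fixed point of `X(K)` (`X/S`) comes from `X(F)`.
[cite: SilvermanAEC2009, Exercise 10.16] -/
theorem exists_map_eq_of_map_eq_tower {S : Type*} [Field S] [Algebra S F] [Algebra S K]
    [IsScalarTower S F K] {X : WeierstrassCurve S} (h2 : finrank F K = 2) {θ : K}
    (hθ : θ ∉ Set.range (algebraMap F K)) (σ : K ≃ₐ[S] K)
    (hσF : ∀ a : F, σ (algebraMap F K a) = algebraMap F K a) (hσ : σ θ = -θ)
    {Q : (X.baseChange K).toAffine.Point} (hQ : Affine.Point.map (W' := X) (σ : K →ₐ[S] K) Q = Q) :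
    ∃ Q₀ : (X.baseChange F).toAffine.Point,
      Affine.Point.map (W' := X) (IsScalarTower.toAlgHom S F K) Q₀ = Q := by
  -- `σ` as an `F`-algebra map
  let σF : K →ₐ[F] K := { (σ : K →ₐ[S] K).toRingHom with commutes' := hσF }
  have hσF' : ∀ x, σF x = σ x := fun _ => rfl
  rcases Q with _ | ⟨x, y, h⟩
  · exact ⟨0, rfl⟩
  · rw [Affine.Point.map_some] at hQ
    simp only [AlgEquiv.coe_toAlgHom, Affine.Point.some.injEq] at hQ
    obtain ⟨a, ha⟩ := exists_algebraMap_eq_of_apply_gen_eq_neg h2 hθ σF (by rw [hσF', hσ])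
      (x := x) (by rw [hσF', hQ.1])
    obtain ⟨b, hb⟩ := exists_algebraMap_eq_of_apply_gen_eq_neg h2 hθ σF (by rw [hσF', hσ])
      (x := y) (by rw [hσF', hQ.2])
    subst ha hb
    refine ⟨.some a b ((Affine.baseChange_nonsingular (W := X) (f := IsScalarTower.toAlgHom S F K)
      (algebraMap F K).injective a b).mp h), ?_⟩
    rw [Affine.Point.map_some]
    rfl

/-- **Point version over `ℚ`**: for `E′ = ℚ(u)` quadratic (`u ∉ ℚ`) and `c ∈ Aut(E′/ℚ)` with `cu = −u`, every
`c`-fixed point of `X(E′)` (`X/ℚ`) is the image of a rational point under the inclusion `QuadraticDescent.incl`.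
[cite: SilvermanAEC2009, Exercise 10.16] -/
theorem exists_incl_eq_of_map_eq_quadratic {E : Type} [Field E] [NumberField E] {X : WeierstrassCurve ℚ}
    (h2E : finrank ℚ E = 2) {u : E} (hu : u ∉ Set.range (algebraMap ℚ E)) (c : E ≃ₐ[ℚ] E) (hcu : c u = -u)
    {Q : (X.baseChange E).toAffine.Point} (hQ : Affine.Point.map (W' := X) (c : E →ₐ[ℚ] E) Q = Q) :
    ∃ Q₀ : X.toAffine.Point, QuadraticDescent.incl E X Q₀ = Q := by
  rcases Q with _ | ⟨x, y, h⟩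
  · exact ⟨0, rfl⟩
  · rw [Affine.Point.map_some] at hQ
    simp only [AlgEquiv.coe_toAlgHom, Affine.Point.some.injEq] at hQ
    obtain ⟨a, ha⟩ := exists_algebraMap_eq_of_apply_gen_eq_neg h2E hu (c : E →ₐ[ℚ] E)
      (by simpa using hcu) (x := x) (by simpa using hQ.1)
    obtain ⟨b, hb⟩ := exists_algebraMap_eq_of_apply_gen_eq_neg h2E hu (c : E →ₐ[ℚ] E)
      (by simpa using hcu) (x := y) (by simpa using hQ.2)
    exact QuadraticDescent.exists_incl_eq X h ha hb

/-- The two inclusions compose: `ι_{E′→H}(ι_{ℚ→E′} R₀) = ι_{ℚ→H} R₀` on points of `X/ℚ`. [folklore] -/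
theorem map_toAlgHom_incl {E H : Type} [Field E] [NumberField E] [Field H] [NumberField H] [Algebra E H]
    (X : WeierstrassCurve ℚ) (R₀ : X.toAffine.Point) :
    Affine.Point.map (W' := X) (IsScalarTower.toAlgHom ℚ E H) (QuadraticDescent.incl E X R₀) =
      QuadraticDescent.incl H X R₀ := by
  exact Affine.Point.map_baseChange (W' := X) (IsScalarTower.toAlgHom ℚ E H) R₀

end Layer

/-! ### §2 The tower descent -/

section Tower

variable {E H : Type} [Field E] [NumberField E] [Field H] [NumberField H] [Algebra E H]
  (V : WeierstrassCurve ℚ) {d e : ℚ} {t : H} {u : E}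

/-- If `t ∉ E′` then `t ∉ ℚ` (through the tower `ℚ → E′ → H`). [folklore] -/
theorem not_mem_range_rat_of_not_mem_range (htE : t ∉ Set.range (algebraMap E H)) :
    t ∉ Set.range (algebraMap ℚ H) := by
  rintro ⟨q, hq⟩
  exact htE ⟨algebraMap ℚ E q, by rw [← IsScalarTower.algebraMap_apply, hq]⟩

/-- An automorphism of the quadratic `E′ = ℚ(u)` with `cu = −u` is an involution. [folklore] -/
theorem apply_apply_eq_self_of_apply_gen_eq_neg (h2E : finrank ℚ E = 2)
    (hu : u ∉ Set.range (algebraMap ℚ E)) (c : E ≃ₐ[ℚ] E) (hcu : c u = -u) (x : E) : c (c x) = x := by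
  obtain ⟨a, b, rfl⟩ := Quadratic.exists_eq_add_mul h2E hu x
  simp only [map_add, map_mul, AlgEquiv.commutes, hcu, map_neg, mul_neg, neg_neg]

/-- **THE TOWER DESCENT, abstract substitutions.** Tower `ℚ ⊂ E′ ⊂ H`, `[H:E′] = 2`, `H = E′(t)`;
`τ ∈ Aut(H/ℚ)` fixing `E′` with `τt = −t`; `E′ = ℚ(u)`, `[E′:ℚ] = 2`, `c ∈ Aut(E′/ℚ)` with `cu = −u`; an additive
isomorphism `Φ : V^{(d)}(H) ≃ V(H)` ANTI-commuting with `τ` and an additive isomorphism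
`Ψ : V^{(d)(e)}(E′) ≃ V^{(d)}(E′)` ANTI-commuting with `c`; `V^{(d)}(ℚ) = ℤP + torsion`; `V^{(d)(e)}(ℚ)` torsion.
Then every `R ∈ V(H)` with `τR = −R` satisfies `2R = k·Φ(ιP) + T`, `T` of finite order: `Q = Φ⁻¹R` is
`τ`-fixed, hence `= ι(Q₀)`, `Q₀ ∈ V^{(d)}(E′)`; `Q₀ + cQ₀` is `c`-fixed hence rational `≡ kP`; `Q₀ − cQ₀ = Ψ(Q₃)`,
`Q₃` `c`-fixed hence rational hence torsion. [cite: GrossZagier1986, V.§2 (p. 311)]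
[cite: SilvermanAEC2009, X.5 Cor. 5.4 and Exercise 10.16] -/
theorem two_smul_eq_zsmul_add_torsion_of_neg_tower (h2 : finrank E H = 2)
    (htE : t ∉ Set.range (algebraMap E H))
    (τ : H ≃ₐ[ℚ] H) (hτE : ∀ a : E, τ (algebraMap E H a) = algebraMap E H a) (hτt : τ t = -t)
    (h2E : finrank ℚ E = 2) (hu : u ∉ Set.range (algebraMap ℚ E)) (c : E ≃ₐ[ℚ] E) (hcu : c u = -u)
    (Φ : ((V.quadraticTwist d).baseChange H).toAffine.Point ≃+ (V.baseChange H).toAffine.Point)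
    (hΦτ : ∀ Q, Affine.Point.map (W' := V) (τ : H →ₐ[ℚ] H) (Φ Q) =
      -Φ (Affine.Point.map (W' := V.quadraticTwist d) (τ : H →ₐ[ℚ] H) Q))
    (Ψ : (((V.quadraticTwist d).quadraticTwist e).baseChange E).toAffine.Point ≃+
      ((V.quadraticTwist d).baseChange E).toAffine.Point)
    (hΨc : ∀ Q, Affine.Point.map (W' := V.quadraticTwist d) (c : E →ₐ[ℚ] E) (Ψ Q) =
      -Ψ (Affine.Point.map (W' := (V.quadraticTwist d).quadraticTwist e) (c : E →ₐ[ℚ] E) Q))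
    {P : (V.quadraticTwist d).toAffine.Point}
    (hgen : ∀ R : (V.quadraticTwist d).toAffine.Point,
      ∃ (k : ℤ) (T : (V.quadraticTwist d).toAffine.Point), IsOfFinAddOrder T ∧ R = k • P + T)
    (htors : ∀ Q : ((V.quadraticTwist d).quadraticTwist e).toAffine.Point, IsOfFinAddOrder Q)
    (R : (V.baseChange H).toAffine.Point)
    (hR : Affine.Point.map (W' := V) (τ : H →ₐ[ℚ] H) R = -R) :
    ∃ (k : ℤ) (T : (V.baseChange H).toAffine.Point), IsOfFinAddOrder T ∧
      (2 : ℤ) • R = k • Φ (QuadraticDescent.incl H (V.quadraticTwist d) P) + T := by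
  -- `Q := Φ⁻¹ R` is `τ`-fixed, hence comes from `E′`
  obtain ⟨Q, rfl⟩ : ∃ Q, Φ Q = R := ⟨Φ.symm R, Φ.apply_symm_apply R⟩
  have hτQ : Affine.Point.map (W' := V.quadraticTwist d) (τ : H →ₐ[ℚ] H) Q = Q := by
    apply Φ.injective
    have h := hΦτ Q
    rw [hR, neg_inj] at h
    exact h.symm
  obtain ⟨Q₀, hQ₀⟩ := exists_map_eq_of_map_eq_tower (S := ℚ) (X := V.quadraticTwist d) h2 htE τ hτE hτt hτQ
  set ιEH := Affine.Point.map (W' := V.quadraticTwist d) (IsScalarTower.toAlgHom ℚ E H) with hιEH_def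
  -- over `E′`: `cQ₀`, the rational part `Q₀ + cQ₀` and the anti part `Q₀ − cQ₀`
  have hcc : ∀ x : E, c (c x) = x := apply_apply_eq_self_of_apply_gen_eq_neg h2E hu c hcu
  set cQ₀ := Affine.Point.map (W' := V.quadraticTwist d) (c : E →ₐ[ℚ] E) Q₀ with hcQ₀_def
  have hccQ : Affine.Point.map (W' := V.quadraticTwist d) (c : E →ₐ[ℚ] E) cQ₀ = Q₀ := by
    rw [hcQ₀_def]
    rcases Q₀ with _ | ⟨x, y, h⟩
    · rfl
    · simp only [Affine.Point.map_some, AlgEquiv.coe_toAlgHom, hcc]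
  -- `Q₀ + cQ₀` is `c`-fixed, hence rational
  have hfix₁ : Affine.Point.map (W' := V.quadraticTwist d) (c : E →ₐ[ℚ] E) (Q₀ + cQ₀) = Q₀ + cQ₀ := by
    rw [map_add, hccQ, ← hcQ₀_def, add_comm]
  obtain ⟨P₁, hP₁⟩ := exists_incl_eq_of_map_eq_quadratic (X := V.quadraticTwist d) h2E hu c hcu hfix₁
  obtain ⟨k, T₀, hT₀, hP₁k⟩ := hgen P₁
  -- `Q₀ − cQ₀` is `c`-anti-fixed, hence `Ψ` of a rational, hence torsion, point of the companion twist
  have hanti : Affine.Point.map (W' := V.quadraticTwist d) (c : E →ₐ[ℚ] E) (Q₀ - cQ₀) = -(Q₀ - cQ₀) := by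
    rw [map_sub, hccQ, ← hcQ₀_def, neg_sub]
  obtain ⟨Q₃, hQ₃⟩ : ∃ Q₃, Ψ Q₃ = Q₀ - cQ₀ := ⟨Ψ.symm _, Ψ.apply_symm_apply _⟩
  have hcQ₃ : Affine.Point.map (W' := (V.quadraticTwist d).quadraticTwist e) (c : E →ₐ[ℚ] E) Q₃ = Q₃ := by
    apply Ψ.injective
    have h := hΨc Q₃
    rw [hQ₃, hanti, neg_inj] at h
    rw [← h, hQ₃]
  obtain ⟨Q₄, hQ₄⟩ := exists_incl_eq_of_map_eq_quadratic (X := (V.quadraticTwist d).quadraticTwist e)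
    h2E hu c hcu hcQ₃
  have hQ₃tors : IsOfFinAddOrder Q₃ := hQ₄ ▸ isOfFinAddOrder_incl _ (htors Q₄)
  have hQ₂tors : IsOfFinAddOrder (Q₀ - cQ₀) := hQ₃ ▸ Ψ.toAddMonoidHom.isOfFinAddOrder hQ₃tors
  -- assemble over `E′`: `2Q₀ = k·ι_E P + (ι_E T₀ + (Q₀ − cQ₀))`
  have h2Q₀ : (2 : ℤ) • Q₀ = k • QuadraticDescent.incl E (V.quadraticTwist d) P +
      (QuadraticDescent.incl E (V.quadraticTwist d) T₀ + (Q₀ - cQ₀)) := by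
    have h : (2 : ℤ) • Q₀ = (Q₀ + cQ₀) + (Q₀ - cQ₀) := by rw [two_zsmul]; abel
    rw [h, ← hP₁, hP₁k, incl_zsmul_add]
    abel
  -- push to `H`: `ι_{E→H} ∘ ι_{ℚ→E} = ι_{ℚ→H}`
  have h2Q : (2 : ℤ) • Q = k • QuadraticDescent.incl H (V.quadraticTwist d) P +
      (QuadraticDescent.incl H (V.quadraticTwist d) T₀ + ιEH (Q₀ - cQ₀)) := by
    rw [← hQ₀, ← map_zsmul, h2Q₀, map_add, map_zsmul, map_add, hιEH_def, map_toAlgHom_incl,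
      map_toAlgHom_incl]
  have hT₀' : IsOfFinAddOrder (QuadraticDescent.incl H (V.quadraticTwist d) T₀) :=
    isOfFinAddOrder_incl (H := H) (V.quadraticTwist d) hT₀
  have hsum : IsOfFinAddOrder (QuadraticDescent.incl H (V.quadraticTwist d) T₀ + ιEH (Q₀ - cQ₀)) :=
    hT₀'.add (ιEH.isOfFinAddOrder hQ₂tors)
  refine ⟨k, Φ (QuadraticDescent.incl H (V.quadraticTwist d) T₀ + ιEH (Q₀ - cQ₀)),
    Φ.toAddMonoidHom.isOfFinAddOrder hsum, ?_⟩
  rw [← map_zsmul, h2Q, map_add, map_zsmul]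

/-- ★ **THE TOWER DESCENT for the road-(C) substitutions — the `χ`-line of `V(H)` is `ℚ·Φ_H(ιP)`.** Tower
`ℚ ⊂ E′ ⊂ H`, `[H:E′] = 2`, `H = E′(t)`, `t² = d`; `τ ∈ Aut(H/ℚ)` fixing `E′` with `τt = −t`; `E′ = ℚ(u)`,
`[E′:ℚ] = 2`, `u² = e`, `c ∈ Aut(E′/ℚ)` with `cu = −u`; `V^{(d)}(ℚ) = ℤP + torsion`; `V^{(d)(e)}(ℚ)` torsion (model
`(V^{(d)})^{(e)} = V^{(de)}`, `quadraticTwist_quadraticTwist`). Then every `R ∈ V(H)` with `τR = −R` satisfies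
`2R = k·Φ_H(ιP) + T`, `T` of finite order, `Φ_H = twistPointEquivOver V _ htd` (cell `b2b-bsdres`), via the
abstract version with `Φ_H` (anti-natural under `τ`) and `Ψ_{E′} = twistPointEquivOver (V^{(d)}) hu hue` over
`E′` (anti-natural under `c`). [cite: GrossZagier1986, V.§2 (p. 311)] [cite: SilvermanAEC2009, X.5 Cor. 5.4 and Exercise 10.16] -/
theorem two_smul_eq_zsmul_memberPoint_add_torsion_tower (h2 : finrank E H = 2)
    (htE : t ∉ Set.range (algebraMap E H)) (htd : t ^ 2 = algebraMap ℚ H d)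
    (τ : H ≃ₐ[ℚ] H) (hτE : ∀ a : E, τ (algebraMap E H a) = algebraMap E H a) (hτt : τ t = -t)
    (h2E : finrank ℚ E = 2) (hu : u ∉ Set.range (algebraMap ℚ E)) (hue : u ^ 2 = algebraMap ℚ E e)
    (c : E ≃ₐ[ℚ] E) (hcu : c u = -u)
    {P : (V.quadraticTwist d).toAffine.Point}
    (hgen : ∀ R : (V.quadraticTwist d).toAffine.Point,
      ∃ (k : ℤ) (T : (V.quadraticTwist d).toAffine.Point), IsOfFinAddOrder T ∧ R = k • P + T)
    (htors : ∀ Q : ((V.quadraticTwist d).quadraticTwist e).toAffine.Point, IsOfFinAddOrder Q)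
    (R : (V.baseChange H).toAffine.Point)
    (hR : Affine.Point.map (W' := V) (τ : H →ₐ[ℚ] H) R = -R) :
    ∃ (k : ℤ) (T : (V.baseChange H).toAffine.Point), IsOfFinAddOrder T ∧
      (2 : ℤ) • R = k • twistPointEquivOver V (not_mem_range_rat_of_not_mem_range htE) htd
        (QuadraticDescent.incl H (V.quadraticTwist d) P) + T :=
  two_smul_eq_zsmul_add_torsion_of_neg_tower V h2 htE τ hτE hτt h2E hu c hcu
    (twistPointEquivOver V (not_mem_range_rat_of_not_mem_range htE) htd)
    (fun Q => map_twistPointEquivOver_of_neg V (not_mem_range_rat_of_not_mem_range htE) htd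
      (not_mem_range_rat_of_not_mem_range htE) htd (τ : H →ₐ[ℚ] H) (by simpa using hτt) Q)
    (twistPointEquivOver (V.quadraticTwist d) hu hue)
    (fun Q => map_twistPointEquivOver_of_neg (V.quadraticTwist d) hu hue hu hue (c : E →ₐ[ℚ] E)
      (by simpa using hcu) Q)
    hgen htors R hR

end Tower

/-! ### §3 The seam in the tower frame -/

section SeamTower

variable {E H : Type} [Field E] [NumberField E] [Field H] [NumberField H] [Algebra E H]
  (V : WeierstrassCurve ℚ) {d e : ℚ} {t : H} {u : E}
  (G : Subgroup (H ≃ₐ[ℚ] H)) (χ : G →* ℂˣ) (s : G → ℤ)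

/-- ★★ **THE SEAM in the tower frame (road (C), crux `PrintCf2.SplitBadTwoRankOneOfFacts`).** Tower
`ℚ ⊂ E′ ⊂ H = E′(t)`, `[H:E′] = 2`, `t² = d`, `t ∉ E′`; `τ ∈ G ≤ Aut(H/ℚ)` fixing `E′` with `τt = −t` and
`χ : G →* ℂˣ` a sign character (`χ = s`, `s(τ) = −1`); `E′ = ℚ(u)`, `[E′:ℚ] = 2`, `u² = e`, `u ∉ ℚ`, `c ∈ Aut(E′/ℚ)`
with `cu = −u`; member `V^{(d)}(ℚ) = ℤP + torsion`; companion `V^{(d)(e)}(ℚ)` torsion. Then for ALL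
`y₁, y₂ ∈ V(H)` there is ONE `r ∈ ℚ` with
`chiHeightPairing V H G χ y₁ y₂ = r·[H:ℚ]·ĥ(P)` and, for every prime `p`, every `ι` and every
`G`-INVARIANT datum `DH`, `chiPAdicPairing ι V H DH G χ y₁ y₂ = r·⟨P′, P′⟩_{DH}`, `P′ = Φ_H(ιP)`.
[cite: Disegni2017, (1.1.3) (arXiv v3 PDF p. 4 L35–41) and Theorem B (PDF p. 8 L11–20)]
[cite: GrossZagier1986, V.§2 (p. 311)] [cite: SilvermanAEC2009, X.5 Cor. 5.4, Exercise 10.16, Prop. VIII.5.4(b)] -/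
theorem exists_rat_chiPairings_eq_tower [V.IsElliptic] [(V.quadraticTwist d).IsElliptic]
    (h2 : finrank E H = 2) (htE : t ∉ Set.range (algebraMap E H)) (htd : t ^ 2 = algebraMap ℚ H d)
    (hs : ∀ σ, ((χ σ : ℂˣ) : ℂ) = (s σ : ℂ)) (τ : H ≃ₐ[ℚ] H) (hτG : τ ∈ G) (hsτ : s ⟨τ, hτG⟩ = -1)
    (hτE : ∀ a : E, τ (algebraMap E H a) = algebraMap E H a) (hτt : τ t = -t)
    (h2E : finrank ℚ E = 2) (hu : u ∉ Set.range (algebraMap ℚ E)) (hue : u ^ 2 = algebraMap ℚ E e)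
    (c : E ≃ₐ[ℚ] E) (hcu : c u = -u)
    {P : (V.quadraticTwist d).toAffine.Point}
    (hgen : ∀ R : (V.quadraticTwist d).toAffine.Point,
      ∃ (k : ℤ) (T : (V.quadraticTwist d).toAffine.Point), IsOfFinAddOrder T ∧ R = k • P + T)
    (htors : ∀ Q : ((V.quadraticTwist d).quadraticTwist e).toAffine.Point, IsOfFinAddOrder Q)
    (y₁ y₂ : (V.baseChange H).toAffine.Point) :
    ∃ r : ℚ,
      chiHeightPairing V H G χ y₁ y₂ =
        (((r : ℝ) * (Module.finrank ℚ H : ℝ) * canonicalHeight P : ℝ) : ℂ) ∧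
      ∀ (p : ℕ) [Fact p.Prime] (ι : PadicAlgCl p ≃+* ℂ) (DH : PAdicHeightDataK V p H),
        (∀ (σ : G) (a b : (V.baseChange H).toAffine.Point),
          DH.pairing (pointGalHom V H σ.1 a) (pointGalHom V H σ.1 b) = DH.pairing a b) →
        chiPAdicPairing ι V H DH G χ y₁ y₂ =
          algebraMap ℚ_[p] ℂ_[p] ((r : ℚ_[p]) *
            DH.pairing
              (twistPointEquivOver V (not_mem_range_rat_of_not_mem_range htE) htd
                (QuadraticDescent.incl H (V.quadraticTwist d) P))
              (twistPointEquivOver V (not_mem_range_rat_of_not_mem_range htE) htd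
                (QuadraticDescent.incl H (V.quadraticTwist d) P))) := by
  have ht : t ∉ Set.range (algebraMap ℚ H) := not_mem_range_rat_of_not_mem_range htE
  set P' := twistPointEquivOver V ht htd (QuadraticDescent.incl H (V.quadraticTwist d) P) with hP'_def
  obtain ⟨k₁, T₁, hT₁, h₁⟩ := two_smul_eq_zsmul_memberPoint_add_torsion_tower V h2 htE htd τ hτE hτt h2E hu
    hue c hcu hgen htors _ (map_sum_sign_smul_eq_neg V G χ s hs hτG hsτ y₁)
  obtain ⟨k₂, T₂, hT₂, h₂⟩ := two_smul_eq_zsmul_memberPoint_add_torsion_tower V h2 htE htd τ hτE hτt h2E hu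
    hue c hcu hgen htors _ (map_sum_sign_smul_eq_neg V G χ s hs hτG hsτ y₂)
  refine ⟨(k₁ * k₂ : ℚ) / (4 * Nat.card G), ?_, fun p _ ι DH hDH => ?_⟩
  · have hNT := card_mul_mul_chiHeightPairing_eq G χ s hs h₁ h₂ hT₁ hT₂
    rw [← hP'_def, canonicalHeight_memberPoint V ht htd P] at hNT
    have hG0' : (Nat.card G : ℂ) ≠ 0 := by exact_mod_cast Nat.card_pos.ne'
    have h4 : (Nat.card G : ℂ) * (2 : ℤ) * (2 : ℤ) = 4 * (Nat.card G : ℂ) := by push_cast; ring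
    rw [h4] at hNT
    have : chiHeightPairing V H G χ y₁ y₂ =
        (4 * (Nat.card G : ℂ))⁻¹ * (((k₁ : ℝ) * (k₂ : ℝ) * ((Module.finrank ℚ H : ℝ) * canonicalHeight P) : ℝ) : ℂ) := by
      rw [← hNT, ← mul_assoc, inv_mul_cancel₀ (mul_ne_zero (by norm_num) hG0'), one_mul]
    rw [this]
    push_cast
    field_simp
  · have hPA := card_mul_mul_chiPAdicPairing_eq ι DH G χ s hs hDH h₁ h₂ hT₁ hT₂
    have hG0' : (Nat.card G : ℂ_[p]) ≠ 0 := by exact_mod_cast Nat.card_pos.ne'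
    have h4 : (Nat.card G : ℂ_[p]) * (2 : ℤ) * (2 : ℤ) = 4 * (Nat.card G : ℂ_[p]) := by push_cast; ring
    rw [h4] at hPA
    have h4' : (4 : ℂ_[p]) * (Nat.card G : ℂ_[p]) ≠ 0 := mul_ne_zero (by norm_num) hG0'
    have : chiPAdicPairing ι V H DH G χ y₁ y₂ =
        (4 * (Nat.card G : ℂ_[p]))⁻¹ * algebraMap ℚ_[p] ℂ_[p] ((k₁ : ℚ_[p]) * (k₂ : ℚ_[p]) * DH.pairing P' P') := by
      rw [← hPA, ← mul_assoc, inv_mul_cancel₀ h4', one_mul]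
    rw [this]
    have hinv : (4 * (Nat.card G : ℂ_[p]))⁻¹ = algebraMap ℚ_[p] ℂ_[p] ((4 * (Nat.card G : ℚ_[p]))⁻¹) := by
      rw [map_inv₀, map_mul, map_natCast, map_ofNat]
    rw [hinv, ← map_mul]
    congr 1
    push_cast
    field_simp

end SeamTower

/-! ### §4 The frame's automorphisms exist by name -/

section Frame

variable {E H : Type} [Field E] [NumberField E] [Field H] [NumberField H] [Algebra E H]

/-- **The `E′`-conjugation of `H = E′(t)` as a `ℚ`-automorphism**: `[H:E′] = 2`, `t ∉ E′`, `t² = d' ∈ E′` ⟹ there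
is `τ ∈ Aut(H/ℚ)` fixing `E′` pointwise with `τt = −t` (the tree's `Quadratic.conj`, an involution, made an
`AlgEquiv` and restricted to `ℚ`). [folklore] -/
theorem exists_algEquiv_tower (h2 : finrank E H = 2) {t : H} {d' : E} (htE : t ∉ Set.range (algebraMap E H))
    (htd : t ^ 2 = algebraMap E H d') :
    ∃ τ : H ≃ₐ[ℚ] H, (∀ a : E, τ (algebraMap E H a) = algebraMap E H a) ∧ τ t = -t := by
  let σ : H →ₐ[E] H := Quadratic.conj h2 htE htd
  have hσσ : σ.comp σ = AlgHom.id E H := AlgHom.ext fun x => Quadratic.conj_conj h2 htE htd x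
  let τE : H ≃ₐ[E] H := AlgEquiv.ofAlgHom σ σ hσσ hσσ
  refine ⟨τE.restrictScalars ℚ, fun a => ?_, ?_⟩
  · exact τE.commutes a
  · exact Quadratic.conj_gen h2 htE htd

/-- The generator `t` of `H = E′(t)` with `t² = d ∈ ℚ` also satisfies `t² = algebraMap E′ H (algebraMap ℚ E′ d)` (the
form `exists_algEquiv_tower` consumes). [folklore] -/
theorem sq_eq_algebraMap_tower {t : H} {d : ℚ} (htd : t ^ 2 = algebraMap ℚ H d) :
    t ^ 2 = algebraMap E H (algebraMap ℚ E d) := by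
  rw [htd, IsScalarTower.algebraMap_apply ℚ E H]

end Frame

end Summit.BirchSwinnertonDyer.BirchSwinnertonDyer.Theorems.PrintCf2.DisegniPairTwo

end
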